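import Literature.AlgebraicGeometry.HodgeTheory.HodgeModelExistence
import Literature.AlgebraicGeometry.HodgeTheory.HypersurfaceLefschetz
import Literature.AlgebraicGeometry.Motives.FanoSchemeOfPlanes
import Literature.AlgebraicGeometry.Motives.Sweep1
import HarnessLib

/-!
# The Hodge conjecture for cubic eightfolds whose variety of 3-planes is smooth (Terasoma 1990)

Family `hodge`, layer `Literature/AlgebraicGeometry/Terasoma1990`. HONEST FRAMING (cell
`pub-hlocus`, Hodge-locus census): certified instances and evidence bearing on the general Hodge
conjecture; no claim. ONE named fact (D-0014), the statement-level typing of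

* T. Terasoma, *Hodge conjecture for cubic 8-folds*, Math. Ann. **288** (1990) 9–19
  [Terasoma1990] (doi:10.1007/bf01444518; MSC 14C30, 14J70, 14C25),

in the pattern of the sibling known case `HodgeTheory/CubicFourfoldHodgeConjecture`
(`hodgeTwoTwo_algebraic_cubicFourfold`, Zucker 1977) and on the same real carriers
(`complexBetti X 8 = H⁸(X(ℂ); ℂ)`, `IsRationalClass`, `IsOfHodgeType 8 X 8 4 4`,
`algebraicClasses X 4 = N⁴H⁸`), with the variety of 3-planes rendered by the tree's Fano scheme
`Motives.fanoSchemeOfPlanes 3 9 ℂ {F} = F₃(V₊(F)) ⊂ 𝔾(3, 9) = G(4, 10)` (file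
`Motives/FanoSchemeOfPlanes`, the Hilbert scheme of 3-planes in `V₊(F)`).

## The printed statement and how it was read

The primary is paywalled in the store (acquisition `acq-01766`, cite-only) but its pages were READ
(2026-08-25, cell hodge-nonav, LIT-DOSSIER §17b) from the open GDZ Göttingen scan of Math. Ann. 288
(PPN235181684_0288, LOG_0008; page renders `run/shared/lean/pub/hodge-nonav/lit/scans/Terasoma1990/`).
**Main theorem, p. 9, verbatim**: "Let `X` be a smooth cubic 8-fold such that `B(X)` is smooth. Then the
Hodge conjecture for codimension 4 holds for `X`." (`B(X)` = "the variety representing the set of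
3-dimensional planes contained in `X`"; p. 9: "We reduce the Hodge conjecture for `X` to that of `B(X)` by
using the algebraic correspondence between `X` and `B(X)`. We prove that the homomorphism induced by this
correspondence is surjective by using 'inductive structure' and the irreducibility of the monodromy
action in the Lefschetz pencil."; §3 p. 14: the incidence variety `I ⊂ Grass(4,10) × ℙ(S₃(ℂ¹⁰))` is
smooth — a projective bundle over the Grassmannian — and Prop. 6 "The morphism `φ : I → M` is
surjective", whence `B(X) = φ⁻¹([X])` is a smooth fourfold for generic `X`.) This agrees with the signed
review **Zbl 0735.14006** (reviewer M. Miyanishi), from which the statement was first typed, verbatim: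
"Let `X` be a cubic
hypersurface in `ℙ⁹`, i.e., a cubic 8-fold, and let `B(X)` be the variety (in Grass (4,10)) of
3-dimensional linear subspaces in `ℙ⁹` contained in `X`. Then `dim(B(X)) ≥ 4`, and `B(X)` is a
smooth 4-fold if `X` is generic. The author shows that if `B(X)` is smooth then the Hodge conjecture
for codimension 4 holds, i.e., the intersection `H⁸(X,ℚ) ∩ H^{4,4}(X)` in
`H⁸(X,ℂ) = ⊕_{i+j=8} H^{i,j}(X)` is generated by algebraic cycles of codimension 4." Secondary
citing contexts agree on the restricted scope: Movasati, arXiv:1602.06607 p. 20 ("for a restricted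
class of cubic 8-folds the Hodge conjecture is also known (see [Terasoma90])"); Shimada,
arXiv:math/0311180 p. 3 lists [Terasoma90] among the cylinder-homomorphism results ("the image
contains the vanishing cycles"); Lewis, in *Transcendental Aspects of Algebraic Cycles* (LMS LN 313)
Lecture 6.2, cites [Te] as an application of cylinder maps. (The phrase "the rational Hodge
conjecture holds for 4-cycles of a smooth cubic 8-fold" of arXiv:1810.12394 p. 10 drops the
hypothesis on `B(X)` and is NOT what the review reports.)

## Rendering and faithfulness

* `X` ranges over `ℂ`-schemes with `Motives.IsSmoothHypersurface 8 3 X` (a smooth projective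
  geometrically integral eightfold which is `V₊(F) ⊆ ℙ⁹_ℂ` for an irreducible cubic form `F`); the
  equation enters through `Motives.IsHypersurfaceCutOutBy 9 F X` for an arbitrary cubic form `F`
  cutting out `X` (any two such forms are proportional, so `F₃(V₊(F))` does not depend on the choice).
* "`B(X)` is smooth" is rendered CONSERVATIVELY as: the structure morphism of the Fano scheme
  `F₃(V₊(F)) → Spec ℂ` is smooth of relative dimension `4` (Mathlib
  `AlgebraicGeometry.SmoothOfRelativeDimension 4`), i.e. `B(X)` is a smooth fourfold — the expected
  dimension `dim G(4,10) - rank Sym³ = 24 - 20 = 4`, which the review records as the generic case.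
  The printed hypothesis (p. 9) IS smoothness of `B(X)` alone (no dimension stated), so the present
  `def` is the special case "smooth of the expected dimension 4" of the printed theorem; it is in no
  reading stronger than the source. `-- TODO(general form): hypothesis "B(X) smooth" without the
  dimension — a WIDER statement, hence a new name if a consumer ever needs it (never edit this def's
  meaning in place); check first in §§3–4 of the primary (pp. 14–19) that the proof uses no
  dimension count on B(X).`
* The conclusion "`H⁸(X,ℚ) ∩ H^{4,4}(X)` is generated by algebraic cycles of codimension 4" is
  membership of every rational class of Hodge type `(4,4)` in `algebraicClasses X 4` (for rational
  classes `ℚ`-span and `ℂ`-span membership agree: module docstring of `HodgeTheory/LefschetzOneOne`).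
* Scope caveats (say what is NOT covered): nothing is asserted for cubic eightfolds whose variety of
  3-planes is singular or of dimension `> 4`; in particular NOTHING is asserted here about the Fermat
  cubic eightfold `x₀³ + ⋯ + x₉³ = 0` (its Hodge classes are algebraic by Shioda 1979, tree fact
  `HodgeTheory.hodgeClasses_algebraic_fermat`, `m = 3` prime) or about the members of the
  Hodge-locus families through it studied by the census `pub-hlocus`: whether `F₃` is a smooth
  fourfold at those members is not checked anywhere in the tree.
* Upper bound: the fact is an instance of the summit statement (`…_of_hodgeConjectureFor`), so
  nothing stronger than the Hodge conjecture is claimed; with the tree's Lefschetz facts it yields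
  `HodgeConjectureFor 8 X` for these `X` (`hodgeConjectureFor_cubicEightfold_of`, proved).

## References

* [Terasoma1990] T. Terasoma, Hodge conjecture for cubic 8-folds, Math. Ann. 288 (1990) 9–19,
  Main theorem (p. 9), §3 Prop. 6 (p. 14) — read from the GDZ scan (store: acq-01766 cite-only);
  review Zbl 0735.14006 (M. Miyanishi).
* [Movasati2016WhyPeriods] H. Movasati, Why should one compute periods of algebraic cycles?,
  arXiv:1602.06607, p. 20 (held, read).
* [Shimada2003VanishingCyclesGHC] I. Shimada, Vanishing cycles, the generalized Hodge conjecture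
  and Gröbner bases, arXiv:math/0311180, p. 3 (held, read).
* [Zucker1977] S. Zucker, Compositio Math. 34 (1977), (3.2) Theorem — the fourfold analogue
  (`HodgeTheory/CubicFourfoldHodgeConjecture`).
* [VoisinHodgeII2003] C. Voisin, Hodge Theory and Complex Algebraic Geometry II, Cor. 1.24–1.25
  (off-middle degrees; tree fact `Voisin2003_smoothHypersurface_algebraicClasses_eq_top`).
* [Deligne2000] P. Deligne, The Hodge conjecture (Clay, 2000), §1.
-/

noncomputable section

open CategoryTheory AlgebraicGeometry

namespace Literature.AlgebraicGeometry.Terasoma1990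

open Literature.AlgebraicGeometry.Motives Literature.AlgebraicGeometry.HodgeTheory

section Terasoma1990

/-! ### The named fact -/

/-- **Rational `(4,4)`-classes on a cubic eightfold whose variety of 3-planes is a smooth fourfold
are algebraic (Terasoma 1990, a KNOWN CASE of the summit statement in degree 8).** Zbl 0735.14006
(M. Miyanishi) on Terasoma, Math. Ann. 288 (1990) 9–19, verbatim up to the bracketed abbreviation
`[HC]` of the summit's name: "Let `X` be a cubic hypersurface in `ℙ⁹`, i.e., a cubic 8-fold, and
let `B(X)` be the variety (in Grass (4,10)) of 3-dimensional linear subspaces in `ℙ⁹` contained in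
`X`. Then `dim(B(X)) ≥ 4`, and `B(X)` is a smooth 4-fold if `X` is generic. The author shows that
if `B(X)` is smooth then the [HC] for codimension 4 holds, i.e., the intersection
`H⁸(X,ℚ) ∩ H^{4,4}(X)` in `H⁸(X,ℂ) = ⊕_{i+j=8} H^{i,j}(X)` is generated by algebraic cycles of
codimension 4." (the full sentence is in the module docstring). Rendering (conservative, see the
module docstring): for `X` a smooth cubic hypersurface of dimension `8` over `ℂ` cut out by the
cubic form `F`, IF the Fano scheme `F₃(V₊(F)) ⊂ G(4,10)` of 3-planes on `X` is smooth over `ℂ` of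
relative dimension `4` (a smooth fourfold, the generic case), THEN every rational class of Hodge
type `(4,4)` in `H⁸(X(ℂ); ℂ)` lies in `algebraicClasses X 4`. This is a THEOREM in print (proved
in the cited paper by the cylinder homomorphism of the family of 3-planes), vendored as a named
fact; primary read (Main theorem p. 9: hypothesis "`B(X)` is smooth"); nothing is asserted when `F₃` is singular or jumps dimension
(in particular nothing about the Fermat cubic eightfold).
[cite: Terasoma1990, Main theorem p. 9; Zbl 0735.14006] -/
def Terasoma1990_hodgeFourFour_algebraic_cubicEightfold : Prop :=
  ∀ ⦃X : Motives.SchemeOver ℂ⦄, Motives.IsSmoothHypersurface 8 3 X →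
    ∀ ⦃F : MvPolynomial (Fin (8 + 2)) ℂ⦄, F.IsHomogeneous 3 →
      Motives.IsHypersurfaceCutOutBy (8 + 1) F X →
        SmoothOfRelativeDimension 4 (Motives.fanoSchemeOfPlanes 3 (8 + 1) ℂ {F}).hom →
          ∀ c : complexBetti X (2 * 4),
            IsRationalClass c → IsOfHodgeType 8 X (2 * 4) 4 4 c → c ∈ algebraicClasses X 4

variable {X : Motives.SchemeOver ℂ}

/-! ### Upper bound: the fact is an instance of the Hodge conjecture -/

/-- The Hodge conjecture for all smooth projective complex varieties (the summit statement, spelled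
with `HodgeConjectureFor`) implies Terasoma's statement: it is its instance in degree `8` over
smooth cubic eightfolds, the hypothesis on the variety of 3-planes being simply dropped.
[cite: Deligne2000, §1] -/
theorem Terasoma1990_hodgeFourFour_algebraic_cubicEightfold_of_hodgeConjectureFor
    (h : ∀ ⦃n : ℕ⦄ ⦃X : Motives.SchemeOver ℂ⦄,
      Motives.IsSmoothProjective n X → HodgeConjectureFor n X) :
    Terasoma1990_hodgeFourFour_algebraic_cubicEightfold :=
  fun _ hX _ _ _ _ c hc hpp ↦ (h hX.1).2 4 c hc hpp

/-! ### Consequences in the summit layer's spelling (proved; no further fact) -/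

/-- **Rational `(p,p)`-classes on a cubic eightfold with smooth fourfold of 3-planes are algebraic in
EVERY codimension `p`**: `p = 4` is the fact; every other `p` is off the middle degree of the
hypersurface, where `H²ᵖ(X(ℂ); ℂ) = ℂ·hᵖ` consists of algebraic classes (Lefschetz hyperplane
theorem and its Poincaré dual, tree fact `Voisin2003_smoothHypersurface_algebraicClasses_eq_top`
assembled with the tree's theorems in degrees `0`, `8` and `> 8`).
[cite: Terasoma1990, Main theorem p. 9; Zbl 0735.14006]
[cite: VoisinHodgeII2003, Cor. 1.24 and Cor. 1.25] -/
theorem hodgeClasses_algebraic_cubicEightfold_of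
    (h : Terasoma1990_hodgeFourFour_algebraic_cubicEightfold)
    (hL : Voisin2003_smoothHypersurface_algebraicClasses_eq_top)
    (hX : Motives.IsSmoothHypersurface 8 3 X) {F : MvPolynomial (Fin (8 + 2)) ℂ}
    (hF : F.IsHomogeneous 3) (hFX : Motives.IsHypersurfaceCutOutBy (8 + 1) F X)
    (hB : SmoothOfRelativeDimension 4 (Motives.fanoSchemeOfPlanes 3 (8 + 1) ℂ {F}).hom)
    (p : ℕ) (c : complexBetti X (2 * p)) (hc : IsRationalClass c)
    (hpp : IsOfHodgeType 8 X (2 * p) p p c) : c ∈ algebraicClasses X p := by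
  by_cases hp : 2 * p = 8
  · obtain rfl : p = 4 := by omega
    exact h hX hF hFX hB c hc hpp
  · exact hL.mem_algebraicClasses hX hp c

/-- **The Hodge conjecture holds for smooth cubic eightfolds whose variety of 3-planes is a smooth
fourfold**, in the summit layer's spelling `HodgeConjectureFor 8 X`: Terasoma's fact, the
off-middle Lefschetz fact, and the existence of a Hodge model (`hA`, the anti-vacuity conjunct).
[cite: Terasoma1990, Main theorem p. 9; Zbl 0735.14006] [cite: Deligne2000, §1] -/
theorem hodgeConjectureFor_cubicEightfold_of
    (h : Terasoma1990_hodgeFourFour_algebraic_cubicEightfold)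
    (hL : Voisin2003_smoothHypersurface_algebraicClasses_eq_top) (hA : nonempty_hodgeModel 8 X)
    (hX : Motives.IsSmoothHypersurface 8 3 X) {F : MvPolynomial (Fin (8 + 2)) ℂ}
    (hF : F.IsHomogeneous 3) (hFX : Motives.IsHypersurfaceCutOutBy (8 + 1) F X)
    (hB : SmoothOfRelativeDimension 4 (Motives.fanoSchemeOfPlanes 3 (8 + 1) ℂ {F}).hom) :
    HodgeConjectureFor 8 X :=
  ⟨hA hX.1, fun p c hc hpp ↦ hodgeClasses_algebraic_cubicEightfold_of h hL hX hF hFX hB p c hc hpp⟩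

/-- Upper bound (sanity): conversely `HodgeConjectureFor 8 X` contains the all-codimension
statement, so nothing beyond the summit statement is proved here. [cite: Deligne2000, §1] -/
theorem hodgeClasses_algebraic_cubicEightfold_of_hodgeConjectureFor (hX8 : HodgeConjectureFor 8 X)
    (p : ℕ) (c : complexBetti X (2 * p)) (hc : IsRationalClass c)
    (hpp : IsOfHodgeType 8 X (2 * p) p p c) : c ∈ algebraicClasses X p :=
  hX8.2 p c hc hpp

end Terasoma1990

end Literature.AlgebraicGeometry.Terasoma1990

end
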